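import Literature.Topology.FourManifolds.QuadPerturbComp
import HarnessLib

/-!
# Second-order genericity for the quadratic family through an immersion

Topic `Literature/Topology/FourManifolds` (programme of the fact
`Literature.Topology.FourManifolds.exists_isSimplifiedBrokenLefschetzFibration`, Baykur–Saeki 2017, §2.1:
generic maps `X⁴ → Σ²` have folds and cusps only).  `OneOneTransversality.lean` proved: for
almost every `θ = (A, B)`, `f + A + B(·,·)` is first-order generic and all its `S_{1,1}` incidence
systems have only nondegenerate zeros.  This file proves the same for the COMPOSITE family
`F_θ = f + θ.1 ∘ h + θ.2(h, h)` (`QuadPerturbComp.lean`), `h` an immersion of the open set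
`Ω ⊆ ℝ⁴` into a finite-dimensional space `G` — the chart representative of the global family
`f + A ∘ ι + B(ι, ι)` through an embedding `ι : M → ℝᴺ`, which is how the theorem is globalised
to compact 4-manifolds:

* `OneJet.contDiffOn_oneOneSystem_comp`, `OneJet.hasFDerivAt_oneOneSystem_comp_param` —
  smoothness of `(θ, u) ↦` system and its (affine) parameter derivative
  `sysOfJetsL ∘ jetCompL(h x, dh_x, D²h_x)`;
* `OneJet.surjective_sysOfJetsL_comp_jetCompL` — **the parameter derivative is onto**
  (ontoness for the plain family, `surjective_oneOneParam`, produces jets `(N, S)` with `S`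
  symmetric; jet realisation `exists_jetCompL_eq` produces `θ` with these jets, `dh_x` being
  injective and `D²h_x` symmetric);
* `OneJet.ae_surjective_fderiv_oneOneSystem_comp` — the Sard engine
  (`Literature.Analysis.Calculus.ae_surjective_fderiv_section`);
* `OneJet.ae_fderiv_quadPerturbComp_ne_zero`, `OneJet.ae_isOneJetTransverseAt_quadPerturbComp`
  — first-order genericity of the same family;
* `OneJet.ae_twoGeneric_quadPerturbComp` — everything at once in the `4 × 2` incidence charts.

Everything is proved; no definitions, no named facts (D-0026).

## References

* M. Golubitsky, V. Guillemin, *Stable Mappings and Their Singularities*, GTM 14 (1973), Ch. II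
  §4, Thm. 4.9; Ch. VI §1, §3 Prop. 3.7, §4, §5 Thm. 5.2. [GolubitskyGuillemin1973]
* M. W. Hirsch, *Differential Topology*, GTM 33 (1976), Ch. 3 §2, Thm. 2.7. [HirschDT1976]
* V. Guillemin, A. Pollack, *Differential Topology* (1974), Ch. 2 §3. [GuilleminPollack2010]
* R. İ. Baykur, O. Saeki, *Simplifying indefinite fibrations on 4-manifolds*, arXiv:1705.11169,
  §2.1, p. 6. [BaykurSaeki2017]
-/

noncomputable section

set_option maxSynthPendingDepth 2

open Set Function Filter MeasureTheory Module
open scoped ContDiff Topology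

namespace Literature.Topology.FourManifolds

namespace OneJet

open Literature.Analysis.Calculus Literature.Analysis.Calculus.ParametricTransversality

section Comp

/-- Local notation for this file: the model space `ℝⁿ = EuclideanSpace ℝ (Fin n)`. -/
local notation "𝔼 " n:arg => EuclideanSpace ℝ (Fin n)

variable {G : Type} [NormedAddCommGroup G] [NormedSpace ℝ G] [FiniteDimensional ℝ G]

/-- Local notation: the parameter space of the composite family. -/
local notation "PG" => ((G →L[ℝ] 𝔼 2) × (G →L[ℝ] G →L[ℝ] 𝔼 2))

variable {f : 𝔼 4 → 𝔼 2} {h : 𝔼 4 → G} {Ω : Set (𝔼 4)}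

/-! ### Smoothness and the parameter derivative of the system -/

omit [FiniteDimensional ℝ G] in
/-- **Joint smoothness of the incidence system of the composite family** in `(θ, u)` on
`univ × (Ω × univ)`. [folklore] -/
theorem contDiffOn_oneOneSystem_comp (hΩ : IsOpen Ω) (hf : ContDiffOn ℝ ∞ f Ω)
    (hh : ContDiffOn ℝ ∞ h Ω) (ℓA ℓB : (𝔼 2) →L[ℝ] ℝ) (a : Fin 4) :
    ContDiffOn ℝ ∞ (fun z : PG × Unknowns => oneOneSystem ℓA ℓB a (quadPerturbComp f h z.1) z.2)
      (univ ×ˢ (Ω ×ˢ univ)) := by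
  set Ω' : Set (PG × Unknowns) := univ ×ˢ (Ω ×ˢ univ) with hΩ'
  have hπ : ContDiff ℝ ∞ fun z : PG × Unknowns => (z.1, z.2.1) :=
    contDiff_fst.prodMk (contDiff_fst.comp contDiff_snd)
  have hπm : MapsTo (fun z : PG × Unknowns => (z.1, z.2.1)) Ω' (univ ×ˢ Ω) :=
    fun z hz => ⟨mem_univ _, hz.2.1⟩
  have hJ₁ : ContDiffOn ℝ ∞ (fun z : PG × Unknowns => fderiv ℝ (quadPerturbComp f h z.1) z.2.1)
      Ω' := by
    have h := (contDiffOn_fderiv_quadPerturbComp hΩ hf hh).comp hπ.contDiffOn hπm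
    exact h
  have hJ₂ : ContDiffOn ℝ ∞
      (fun z : PG × Unknowns => fderiv ℝ (fderiv ℝ (quadPerturbComp f h z.1)) z.2.1) Ω' := by
    have h := (contDiffOn_fderiv_fderiv_quadPerturbComp hΩ hf hh).comp hπ.contDiffOn hπm
    exact h
  have hc : ContDiff ℝ ∞ fun z : PG × Unknowns => z.2.2.1 :=
    contDiff_fst.comp (contDiff_snd.comp contDiff_snd)
  have hy : ContDiff ℝ ∞ fun z : PG × Unknowns => z.2.2.2.1 :=
    contDiff_fst.comp (contDiff_snd.comp (contDiff_snd.comp contDiff_snd))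
  have hτ : ContDiff ℝ ∞ fun z : PG × Unknowns => z.2.2.2.2 :=
    contDiff_snd.comp (contDiff_snd.comp (contDiff_snd.comp contDiff_snd))
  have h := contDiffOn_sysOfJetsL_apply ℓA ℓB a hc.contDiffOn hy.contDiffOn hτ.contDiffOn hJ₁ hJ₂
  refine h.congr ?_
  rintro ⟨θ, x, c, y, τ⟩ _
  exact oneOneSystem_eq_sysOfJetsL ℓA ℓB a _ x c y τ

omit [FiniteDimensional ℝ G] in
/-- **The system of the composite family is affine in `θ`**, with derivative
`sysOfJetsL ∘ jetCompL(h x, dh_x, D²h_x)`. [folklore] -/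
theorem hasFDerivAt_oneOneSystem_comp_param (hΩ : IsOpen Ω) (hf : ContDiffOn ℝ ∞ f Ω)
    (hh : ContDiffOn ℝ ∞ h Ω) (ℓA ℓB : (𝔼 2) →L[ℝ] ℝ) (a : Fin 4) {x : 𝔼 4} (hx : x ∈ Ω)
    (c : ℝ) (y : 𝔼 3) (τ : ℝ) (θ : PG) :
    HasFDerivAt (fun ϑ : PG => oneOneSystem ℓA ℓB a (quadPerturbComp f h ϑ) (x, (c, (y, τ))))
      ((sysOfJetsL ℓA ℓB a c y τ).comp
        (jetCompL (h x) (fderiv ℝ h x) (fderiv ℝ (fderiv ℝ h) x))) θ := by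
  have hfun : (fun ϑ : PG => oneOneSystem ℓA ℓB a (quadPerturbComp f h ϑ) (x, (c, (y, τ)))) =
      fun ϑ => sysOfJetsL ℓA ℓB a c y τ (fderiv ℝ f x, fderiv ℝ (fderiv ℝ f) x) +
        ((sysOfJetsL ℓA ℓB a c y τ).comp
          (jetCompL (h x) (fderiv ℝ h x) (fderiv ℝ (fderiv ℝ h) x))) ϑ := by
    funext ϑ
    rw [oneOneSystem_eq_sysOfJetsL, jets_quadPerturbComp_of_mem hΩ hf hh ϑ hx, map_add]
    rfl
  rw [hfun]
  exact ((sysOfJetsL ℓA ℓB a c y τ).comp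
    (jetCompL (h x) (fderiv ℝ h x) (fderiv ℝ (fderiv ℝ h) x))).hasFDerivAt.const_add _

/-- **The parameter derivative of the system of the composite family is onto** whenever `dh_x`
is injective and `D²h_x` symmetric. [cite: GolubitskyGuillemin1973, Ch. II §4, proof of Thm. 4.9] -/
theorem surjective_sysOfJetsL_comp_jetCompL {ℓA ℓB : (𝔼 2) →L[ℝ] ℝ} {uA uB : 𝔼 2}
    (hA1 : ℓA uA = 1) (hB1 : ℓB uA = 0) (hA2 : ℓA uB = 0) (hB2 : ℓB uB = 1) (a : Fin 4)
    (c : ℝ) (y : 𝔼 3) (τ : ℝ) (p : G) {A : 𝔼 4 →L[ℝ] G} (hA : Injective A)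
    {K : 𝔼 4 →L[ℝ] 𝔼 4 →L[ℝ] G} (hK : ∀ v w, K v w = K w v) :
    Surjective ((sysOfJetsL ℓA ℓB a c y τ).comp (jetCompL p A K)) := by
  intro t
  obtain ⟨ϑ, hϑ⟩ := surjective_oneOneParam hA1 hB1 hA2 hB2 a 0 c y τ t
  rw [oneOneParam_eq_sysOfJetsL] at hϑ
  have hS : ∀ v w, jetTwoParam (𝔼 4) (𝔼 2) ϑ v w = jetTwoParam (𝔼 4) (𝔼 2) ϑ w v := by
    intro v w
    rw [jetTwoParam_apply]
    simp only [_root_.add_apply, ContinuousLinearMap.flip_apply]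
    exact add_comm _ _
  obtain ⟨θ, hθ⟩ := exists_jetCompL_eq hA hK p (jetOneParam (F := 𝔼 2) 0 ϑ) hS
  exact ⟨θ, by rw [ContinuousLinearMap.comp_apply, hθ, hϑ]⟩

/-- `2 ≤ ∞` in `WithTop ℕ∞`. [folklore] -/
private theorem two_le_infty₁ : (2 : WithTop ℕ∞) ≤ ∞ := WithTop.coe_le_coe.2 le_top

omit [FiniteDimensional ℝ G] in
/-- The second differential of a `C^∞` map on an open set is symmetric. [folklore] -/
theorem fderiv_fderiv_symm_of_contDiffOn (hΩ : IsOpen Ω) (hh : ContDiffOn ℝ ∞ h Ω) {x : 𝔼 4}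
    (hx : x ∈ Ω) (v w : 𝔼 4) :
    fderiv ℝ (fderiv ℝ h) x v w = fderiv ℝ (fderiv ℝ h) x w v :=
  ((hh.contDiffAt (hΩ.mem_nhds hx)).isSymmSndFDerivAt
    (by simp only [minSmoothness_of_isRCLikeNormedField]; exact two_le_infty₁)) v w

/-! ### Second-order genericity of the composite family -/

/-- **Second-order genericity for the composite family.**  If `h` is an immersion of the open
`Ω ⊆ ℝ⁴`, then for almost every `θ` every zero over `Ω` of the incidence system of `S_{1,1}` for
`F_θ = f + θ.1 ∘ h + θ.2(h, h)` is nondegenerate.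
[cite: GolubitskyGuillemin1973, Ch. II §4, Thm. 4.9; Ch. VI §4; Ch. VI §5, Thm. 5.2]
[cite: HirschDT1976, Ch. 3 §2, Thm. 2.7] -/
theorem ae_surjective_fderiv_oneOneSystem_comp (μ : Measure PG) [μ.IsAddHaarMeasure]
    (hΩ : IsOpen Ω) (hf : ContDiffOn ℝ ∞ f Ω) (hh : ContDiffOn ℝ ∞ h Ω)
    (hinj : ∀ x ∈ Ω, Injective (fderiv ℝ h x)) {ℓA ℓB : (𝔼 2) →L[ℝ] ℝ} {uA uB : 𝔼 2}
    (hA1 : ℓA uA = 1) (hB1 : ℓB uA = 0) (hA2 : ℓA uB = 0) (hB2 : ℓB uB = 1) (a : Fin 4) :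
    ∀ᵐ θ ∂μ, ∀ u : Unknowns, u.1 ∈ Ω → oneOneSystem ℓA ℓB a (quadPerturbComp f h θ) u = 0 →
      Surjective (fderiv ℝ (oneOneSystem ℓA ℓB a (quadPerturbComp f h θ)) u) := by
  set Gm : PG × Unknowns → Values :=
    fun z => oneOneSystem ℓA ℓB a (quadPerturbComp f h z.1) z.2 with hGm
  set Ω' : Set (PG × Unknowns) := univ ×ˢ (Ω ×ˢ univ) with hΩ'
  have hΩ'o : IsOpen Ω' := isOpen_univ.prod (hΩ.prod isOpen_univ)
  have hGs : ContDiffOn ℝ ∞ Gm Ω' := contDiffOn_oneOneSystem_comp hΩ hf hh ℓA ℓB a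
  have h₁ : ∀ z ∈ Ω', Gm z = 0 →
      Surjective (fderiv ℝ Gm z ∘L ContinuousLinearMap.inl ℝ PG Unknowns) := by
    intro z hz _
    have hd : HasFDerivAt Gm (fderiv ℝ Gm z) z :=
      ((hGs.contDiffAt (hΩ'o.mem_nhds hz)).differentiableAt (by simp)).hasFDerivAt
    have hsec : HasFDerivAt (fun p : PG => Gm (p, z.2))
        ((sysOfJetsL ℓA ℓB a z.2.2.1 z.2.2.2.1 z.2.2.2.2).comp
          (jetCompL (h z.2.1) (fderiv ℝ h z.2.1) (fderiv ℝ (fderiv ℝ h) z.2.1))) z.1 :=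
      hasFDerivAt_oneOneSystem_comp_param hΩ hf hh ℓA ℓB a hz.2.1 _ _ _ z.1
    rw [← (hasFDerivAt_curry_left hd).fderiv, hsec.fderiv]
    exact surjective_sysOfJetsL_comp_jetCompL hA1 hB1 hA2 hB2 a _ _ _ _ (hinj _ hz.2.1)
      (fderiv_fderiv_symm_of_contDiffOn hΩ hh hz.2.1)
  have hae := ae_surjective_fderiv_section μ hΩ'o hGs h₁
  filter_upwards [hae] with θ hθ u hu h0
  exact hθ u ⟨mem_univ _, hu, mem_univ _⟩ h0

/-! ### First-order genericity of the composite family -/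

omit [FiniteDimensional ℝ G] in
/-- The 1-jet of the composite family is affine in `θ` with derivative `pr₁ ∘ jetCompL`.
[folklore] -/
theorem hasFDerivAt_fderiv_quadPerturbComp_param (hΩ : IsOpen Ω) (hf : ContDiffOn ℝ ∞ f Ω)
    (hh : ContDiffOn ℝ ∞ h Ω) {x : 𝔼 4} (hx : x ∈ Ω) (θ : PG) :
    HasFDerivAt (fun ϑ : PG => fderiv ℝ (quadPerturbComp f h ϑ) x)
      ((ContinuousLinearMap.fst ℝ (𝔼 4 →L[ℝ] 𝔼 2) (𝔼 4 →L[ℝ] 𝔼 4 →L[ℝ] 𝔼 2)).comp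
        (jetCompL (h x) (fderiv ℝ h x) (fderiv ℝ (fderiv ℝ h) x))) θ := by
  have hfun : (fun ϑ : PG => fderiv ℝ (quadPerturbComp f h ϑ) x) =
      fun ϑ => fderiv ℝ f x +
        ((ContinuousLinearMap.fst ℝ (𝔼 4 →L[ℝ] 𝔼 2) (𝔼 4 →L[ℝ] 𝔼 4 →L[ℝ] 𝔼 2)).comp
          (jetCompL (h x) (fderiv ℝ h x) (fderiv ℝ (fderiv ℝ h) x))) ϑ := by
    funext ϑ
    rw [fderiv_quadPerturbComp_of_mem hΩ hf hh ϑ hx, ContinuousLinearMap.comp_apply,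
      jetCompL_apply]
    rfl
  rw [hfun]
  exact (((ContinuousLinearMap.fst ℝ (𝔼 4 →L[ℝ] 𝔼 2) (𝔼 4 →L[ℝ] 𝔼 4 →L[ℝ] 𝔼 2)).comp
    (jetCompL (h x) (fderiv ℝ h x) (fderiv ℝ (fderiv ℝ h) x))).hasFDerivAt).const_add _

/-- **For almost every `θ` the differential of the composite family vanishes nowhere on `Ω`.**
[cite: GolubitskyGuillemin1973, Ch. II §4, Thm. 4.9; Ch. VI §1, Prop. 1.1]
[cite: HirschDT1976, Ch. 3 §2, Thm. 2.7] -/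
theorem ae_fderiv_quadPerturbComp_ne_zero (μ : Measure PG) [μ.IsAddHaarMeasure]
    (hΩ : IsOpen Ω) (hf : ContDiffOn ℝ ∞ f Ω) (hh : ContDiffOn ℝ ∞ h Ω)
    (hinj : ∀ x ∈ Ω, Injective (fderiv ℝ h x)) :
    ∀ᵐ θ ∂μ, ∀ x ∈ Ω, fderiv ℝ (quadPerturbComp f h θ) x ≠ 0 := by
  set Gm : PG × 𝔼 4 → (𝔼 4 →L[ℝ] 𝔼 2) := fun z => fderiv ℝ (quadPerturbComp f h z.1) z.2
    with hGm
  have hΩ' : IsOpen ((univ : Set PG) ×ˢ Ω) := isOpen_univ.prod hΩ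
  have hGs : ContDiffOn ℝ ∞ Gm (univ ×ˢ Ω) := contDiffOn_fderiv_quadPerturbComp hΩ hf hh
  have h₁ : ∀ z ∈ (univ : Set PG) ×ˢ Ω, Gm z = 0 →
      Surjective (fderiv ℝ Gm z ∘L ContinuousLinearMap.inl ℝ PG (𝔼 4)) := by
    intro z hz _
    have hd : HasFDerivAt Gm (fderiv ℝ Gm z) z :=
      ((hGs.contDiffAt (hΩ'.mem_nhds hz)).differentiableAt (by simp)).hasFDerivAt
    have hsec := hasFDerivAt_fderiv_quadPerturbComp_param hΩ hf hh hz.2 z.1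
    rw [← (hasFDerivAt_curry_left hd).fderiv, hsec.fderiv]
    intro N
    obtain ⟨θ, hθ⟩ := exists_jetCompL_eq (hinj _ hz.2) (fderiv_fderiv_symm_of_contDiffOn hΩ hh hz.2)
      (h z.2) N (S := 0) (fun _ _ => rfl)
    exact ⟨θ, by simp [hθ]⟩
  have hae := ae_forall_ne_zero_of_finrank_lt μ hΩ' hGs h₁ finrank_euclideanFour_lt
  filter_upwards [hae] with p hp x hx
  exact hp x ⟨mem_univ _, hx⟩

set_option maxHeartbeats 400000 in
/-- **For almost every `θ` the composite family is 1-jet-transverse at every point of `Ω`.**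
[cite: GolubitskyGuillemin1973, Ch. II §4, Thm. 4.9; Ch. VI §1, Def. 1.5; Ch. VI §3, Prop. 3.7]
[cite: HirschDT1976, Ch. 3 §2, Thm. 2.7] -/
theorem ae_isOneJetTransverseAt_quadPerturbComp (μ : Measure PG) [μ.IsAddHaarMeasure]
    (hΩ : IsOpen Ω) (hf : ContDiffOn ℝ ∞ f Ω) (hh : ContDiffOn ℝ ∞ h Ω)
    (hinj : ∀ x ∈ Ω, Injective (fderiv ℝ h x)) :
    ∀ᵐ θ ∂μ, ∀ x ∈ Ω, IsOneJetTransverseAt (quadPerturbComp f h θ) x := by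
  set Gm : PG × (𝔼 4 × ((𝔼 2) →L[ℝ] ℝ)) → (𝔼 4 →L[ℝ] ℝ) :=
    fun z => z.2.2.comp (fderiv ℝ (quadPerturbComp f h z.1) z.2.1) with hGm
  set Ω' : Set (PG × (𝔼 4 × ((𝔼 2) →L[ℝ] ℝ))) := univ ×ˢ (Ω ×ˢ {ℓ | ℓ ≠ 0}) with hΩ'
  have hΩ'o : IsOpen Ω' := isOpen_univ.prod (hΩ.prod isOpen_ne)
  have hM : ContDiffOn ℝ ∞ (fun z : PG × (𝔼 4 × ((𝔼 2) →L[ℝ] ℝ)) =>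
      fderiv ℝ (quadPerturbComp f h z.1) z.2.1) Ω' := by
    have hπ : ContDiff ℝ ∞ fun z : PG × (𝔼 4 × ((𝔼 2) →L[ℝ] ℝ)) => (z.1, z.2.1) :=
      contDiff_fst.prodMk (contDiff_fst.comp contDiff_snd)
    have hπm : MapsTo (fun z : PG × (𝔼 4 × ((𝔼 2) →L[ℝ] ℝ)) => (z.1, z.2.1)) Ω' (univ ×ˢ Ω) :=
      fun z hz => ⟨mem_univ _, hz.2.1⟩
    have h := (contDiffOn_fderiv_quadPerturbComp hΩ hf hh).comp hπ.contDiffOn hπm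
    exact h
  have hGs : ContDiffOn ℝ ∞ Gm Ω' := (contDiff_snd.comp contDiff_snd).contDiffOn.clm_comp hM
  have h₁ : ∀ z ∈ Ω', Gm z = 0 →
      Surjective (fderiv ℝ Gm z ∘L
        ContinuousLinearMap.inl ℝ PG (𝔼 4 × ((𝔼 2) →L[ℝ] ℝ))) := by
    intro z hz _
    have hd : HasFDerivAt Gm (fderiv ℝ Gm z) z :=
      ((hGs.contDiffAt (hΩ'o.mem_nhds hz)).differentiableAt (by simp)).hasFDerivAt
    set Lc := ContinuousLinearMap.compL ℝ (𝔼 4) (𝔼 2) ℝ z.2.2 with hLc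
    have hsec : HasFDerivAt (fun q : PG => Gm (q, z.2))
        (Lc.comp ((ContinuousLinearMap.fst ℝ (𝔼 4 →L[ℝ] 𝔼 2) (𝔼 4 →L[ℝ] 𝔼 4 →L[ℝ] 𝔼 2)).comp
          (jetCompL (h z.2.1) (fderiv ℝ h z.2.1) (fderiv ℝ (fderiv ℝ h) z.2.1)))) z.1 := by
      have h := Lc.hasFDerivAt.comp z.1
        (hasFDerivAt_fderiv_quadPerturbComp_param hΩ hf hh hz.2.1 z.1)
      exact h
    rw [← (hasFDerivAt_curry_left hd).fderiv, hsec.fderiv]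
    obtain ⟨u, hu⟩ := exists_apply_eq_one hz.2.2
    intro φ
    obtain ⟨θ, hθ⟩ := exists_jetCompL_eq (hinj _ hz.2.1)
      (fderiv_fderiv_symm_of_contDiffOn hΩ hh hz.2.1) (h z.2.1) (φ.smulRight u) (S := 0)
      (fun _ _ => rfl)
    refine ⟨θ, ?_⟩
    ext v
    simp [hLc, hθ, ContinuousLinearMap.compL_apply, hu]
  have hae := ae_surjective_fderiv_section μ hΩ'o hGs h₁
  filter_upwards [hae] with θ hθ x hx
  intro ℓ hℓ hcomp k hk hv
  have hz : (θ, (x, ℓ)) ∈ Ω' := ⟨mem_univ _, hx, hℓ⟩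
  have h0 : Gm (θ, (x, ℓ)) = 0 := hcomp
  have hsurj := hθ (x, ℓ) hz h0
  have hgs : ContDiffOn ℝ ∞ (quadPerturbComp f h θ) Ω := contDiffOn_quadPerturbComp hf hh θ
  have hg' : ContDiffOn ℝ ∞ (fderiv ℝ (quadPerturbComp f h θ)) Ω :=
    hgs.fderiv_of_isOpen hΩ (by simp)
  have hdg : HasFDerivAt (fderiv ℝ (quadPerturbComp f h θ))
      (fderiv ℝ (fderiv ℝ (quadPerturbComp f h θ)) x) x :=
    ((hg'.contDiffAt (hΩ.mem_nhds hx)).differentiableAt (by simp)).hasFDerivAt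
  have hd : HasFDerivAt
      (fun y : 𝔼 4 × ((𝔼 2) →L[ℝ] ℝ) => fderiv ℝ (quadPerturbComp f h θ) y.1)
      ((fderiv ℝ (fderiv ℝ (quadPerturbComp f h θ)) x).comp
        (ContinuousLinearMap.fst ℝ (𝔼 4) ((𝔼 2) →L[ℝ] ℝ))) (x, ℓ) :=
    hdg.comp (x, ℓ) hasFDerivAt_fst
  have hc : HasFDerivAt (fun y : 𝔼 4 × ((𝔼 2) →L[ℝ] ℝ) => y.2)
      (ContinuousLinearMap.snd ℝ (𝔼 4) ((𝔼 2) →L[ℝ] ℝ)) (x, ℓ) := hasFDerivAt_snd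
  have hT := hc.clm_comp hd
  have hTeq : fderiv ℝ (fun y : 𝔼 4 × ((𝔼 2) →L[ℝ] ℝ) => Gm (θ, y)) (x, ℓ) =
      (ContinuousLinearMap.compL ℝ (𝔼 4) (𝔼 2) ℝ ℓ).comp
          ((fderiv ℝ (fderiv ℝ (quadPerturbComp f h θ)) x).comp
            (ContinuousLinearMap.fst ℝ (𝔼 4) ((𝔼 2) →L[ℝ] ℝ))) +
        ((ContinuousLinearMap.compL ℝ (𝔼 4) (𝔼 2) ℝ).flip
            (fderiv ℝ (quadPerturbComp f h θ) x)).comp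
          (ContinuousLinearMap.snd ℝ (𝔼 4) ((𝔼 2) →L[ℝ] ℝ)) := hT.fderiv
  rw [hTeq] at hsurj
  refine eq_zero_of_surjective_incidence (g := quadPerturbComp f h θ) (ℓ := ℓ) ?_ hk hv
  intro φ
  obtain ⟨vl, hvl⟩ := hsurj φ
  refine ⟨vl, ?_⟩
  rw [← hvl]
  simp [ContinuousLinearMap.compL_apply]

/-! ### Everything at once -/

/-- **Second-order genericity of the composite family, all incidence charts at once.**  For
almost every `θ`: `F_θ` has nowhere-vanishing differential on `Ω`, is 1-jet-transverse at every
point of `Ω`, and every zero over `Ω` of each of the `4 × 2` incidence systems of `S_{1,1}` is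
nondegenerate. [cite: GolubitskyGuillemin1973, Ch. II §4, Thm. 4.9; Ch. VI §4; Ch. VI §5, Thm. 5.2]
[cite: HirschDT1976, Ch. 3 §2, Thm. 2.7] [cite: BaykurSaeki2017, §2.1, p. 6] -/
theorem ae_twoGeneric_quadPerturbComp (μ : Measure PG) [μ.IsAddHaarMeasure]
    (hΩ : IsOpen Ω) (hf : ContDiffOn ℝ ∞ f Ω) (hh : ContDiffOn ℝ ∞ h Ω)
    (hinj : ∀ x ∈ Ω, Injective (fderiv ℝ h x)) :
    ∀ᵐ θ ∂μ, (∀ x ∈ Ω, fderiv ℝ (quadPerturbComp f h θ) x ≠ 0 ∧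
        IsOneJetTransverseAt (quadPerturbComp f h θ) x) ∧
      ∀ a : Fin 4, ∀ i : Fin 2, ∀ u : Unknowns, u.1 ∈ Ω →
        oneOneSystem (EuclideanSpace.proj i) (EuclideanSpace.proj (i + 1)) a
            (quadPerturbComp f h θ) u = 0 →
          Surjective (fderiv ℝ (oneOneSystem (EuclideanSpace.proj i)
            (EuclideanSpace.proj (i + 1)) a (quadPerturbComp f h θ)) u) := by
  have hchart : ∀ i : Fin 2,
      (EuclideanSpace.proj i : (𝔼 2) →L[ℝ] ℝ) (EuclideanSpace.single i (1 : ℝ)) = 1 ∧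
      (EuclideanSpace.proj (i + 1) : (𝔼 2) →L[ℝ] ℝ) (EuclideanSpace.single i (1 : ℝ)) = 0 ∧
      (EuclideanSpace.proj i : (𝔼 2) →L[ℝ] ℝ) (EuclideanSpace.single (i + 1) (1 : ℝ)) = 0 ∧
      (EuclideanSpace.proj (i + 1) : (𝔼 2) →L[ℝ] ℝ) (EuclideanSpace.single (i + 1) (1 : ℝ))
        = 1 := by
    intro i
    fin_cases i <;> simp
  have hsys : ∀ a : Fin 4, ∀ i : Fin 2, ∀ᵐ θ ∂μ, ∀ u : Unknowns, u.1 ∈ Ω →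
      oneOneSystem (EuclideanSpace.proj i) (EuclideanSpace.proj (i + 1)) a
          (quadPerturbComp f h θ) u = 0 →
        Surjective (fderiv ℝ (oneOneSystem (EuclideanSpace.proj i)
          (EuclideanSpace.proj (i + 1)) a (quadPerturbComp f h θ)) u) := fun a i =>
    ae_surjective_fderiv_oneOneSystem_comp μ hΩ hf hh hinj (hchart i).1 (hchart i).2.1
      (hchart i).2.2.1 (hchart i).2.2.2 a
  have hsys' : ∀ᵐ θ ∂μ, ∀ a : Fin 4, ∀ i : Fin 2, ∀ u : Unknowns, u.1 ∈ Ω →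
      oneOneSystem (EuclideanSpace.proj i) (EuclideanSpace.proj (i + 1)) a
          (quadPerturbComp f h θ) u = 0 →
        Surjective (fderiv ℝ (oneOneSystem (EuclideanSpace.proj i)
          (EuclideanSpace.proj (i + 1)) a (quadPerturbComp f h θ)) u) := by
    rw [ae_all_iff]
    intro a
    rw [ae_all_iff]
    exact hsys a
  filter_upwards [ae_fderiv_quadPerturbComp_ne_zero μ hΩ hf hh hinj,
    ae_isOneJetTransverseAt_quadPerturbComp μ hΩ hf hh hinj, hsys'] with θ h1 h2 h3
  exact ⟨fun x hx => ⟨h1 x hx, h2 x hx⟩, h3⟩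

end Comp

end OneJet

end Literature.Topology.FourManifolds
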